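import Mathlib
import HarnessLib
import Literature.MathematicalPhysics.QuantumLattice.GaugeGroups
import Literature.MathematicalPhysics.QuantumFieldTheory.ConstructiveQFTWave0
import Literature.MathematicalPhysics.QuantumFieldTheory.U1GinibreComparison
import Literature.MathematicalPhysics.QuantumFieldTheory.GaussianToolkit
import Summits.Ventures.LatticeQCDFlow.Exactness.CompactHaar
import Summits.Ventures.LatticeQCDFlow.Scaling.HaarConvolutionRatio
import Summits.Ventures.LatticeQCDFlow.Scaling.LatticePeeling
import Summits.Ventures.LatticeQCDFlow.Scaling.FluxTunnellingU1Explicit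
import Summits.Ventures.LatticeQCDFlow.Scaling.ConvolutionPowerCompensation

/-!
# The tilted patch law of the `U(1)` Wilson weight: product integrals, the rotated MGF, the events, the tilt identity

HONEST FRAMING: exact (Metropolis-corrected) sampling algorithms for lattice gauge theory;
figures of merit are autocorrelation/cost numbers at stated couplings and volumes; no
continuum-physics claim.

Venture `LatticeQCDFlow` (cell pub-lqcd), topic `Scaling`, FANOUT row 29 (theory2, gen-20), item 103a
(first half of item 103; the estimate itself is `Scaling/TiltedPatchEstimate.lean`).  NEW WORK over
Mathlib, lean-1's `Scaling/HaarConvolutionRatio` and item 101 (`u1W`, `z1_eq_lintegral_u1W`); nothing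
here is cited as a fact.  `ι` a finite index type (the patch lives in `P : Finset ι`), `w_κ = u1W κ`,
`z₁(κ) = ∫ w_κ dHaar`.

* §1 `lintegral_prod_finset_eq`, `lintegral_prod_u1W` — `∫ ∏_{x∈P} f_x(y_x) dHaar^{⊗ι} = ∏_{x∈P} ∫ f_x`,
  `∫ ∏_{x∈P} w_κ(y_x) = z₁(κ)^{#P}`; `u1W_anti`, `z1_u1_anti` (monotonicity in `κ`);
* §2 `lintegral_exp_im_mul_u1W_le` — the ROTATED moment generating function, no Bessel functions:
  `∫ e^{l·Im y} w_κ(y) dHaar(y) ≤ e^{l²/(2κ)}·z₁(κ)` for `κ > 0` (complete the square: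
  `κ Re y + l Im y = R·Re(e^{−iφ}y)` with `R = √(κ² + l²) ≤ κ + l²/(2κ)`, then rotation invariance);
* §3 the events `goodY P η C = {∀ x ∈ P, Re y_x > −C} ∩ {−η ≤ Σ_P Im y_x ≤ 0}`, its mirror `goodY'`
  (`Σ ≥ 0`), and `goodG P θ η C = {g : (e^{iθ}g_x)_x ∈ goodY}`; measurability; `goodG_congr`
  (membership depends only on the coordinates in `P`);
* §4 the TILT IDENTITY `u1W_rot_eq`: `w_β(e^{−iθ}y) = e^{−(β − β cos θ)}·e^{β sin θ·Im y}·w_{β cos θ}(y)`,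
  the action change in half-angle variables `re_rot_sub_re_rot`:
  `Re(e^{−iθ}y) − Re(e^{iθ}y) = 2 sin θ·Im y`, `exp_neg_le_prod_exp` (on the good event the tilt
  factors multiply to `≥ e^{−β sin θ·η}`), and the TILTED LOWER BOUND **`lintegral_goodG_ge`**:
  `e^{−(Nβ(1−cos θ) + β sin θ·η)}·∫ 1_{goodY}(y) ∏_P w_κ(y_x) ≤ ∫ 1_{goodG}(g) ∏_P w_β(g_x)` (`N = #P`,
  `κ = β cos θ`, `sin θ ≥ 0`) — the sharp exponent; the central event is estimated in item 103b.
Elementary; `def`s `sumIm`, `goodY`, `goodY'`, `goodG` (events as named sets).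
-/

noncomputable section

namespace Summit.Ventures.LatticeQCDFlow.Theory2.HaarConv

open MeasureTheory Real
open Literature.MathematicalPhysics.QuantumFieldTheory Literature.MathematicalPhysics.QuantumLattice
open scoped ENNReal

variable {ι : Type*} [Fintype ι]

/-! ## §1 Product integrals over a patch -/

/-- `∫ ∏_{i∈P} Fᵢ(yᵢ) dHaar^{⊗ι} = ∏_{i∈P} ∫ Fᵢ dHaar`. [folklore] -/
theorem lintegral_prod_finset_eq (P : Finset ι) {F : ι → Circle → ℝ≥0∞} (hF : ∀ i, Measurable (F i)) :
    ∫⁻ y, ∏ i ∈ P, F i (y i) ∂(Measure.pi fun _ : ι => haarProbability Circle) =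
      ∏ i ∈ P, ∫⁻ z, F i z ∂(haarProbability Circle) := by
  classical
  have hF' : ∀ i, Measurable fun z : Circle => if i ∈ P then F i z else 1 := by
    intro i; split_ifs
    · exact hF i
    · exact measurable_const
  have h1 : (fun y : ι → Circle => ∏ i ∈ P, F i (y i)) =
      fun y => ∏ i, (fun i z => if i ∈ P then F i z else (1 : ℝ≥0∞)) i (y i) := by
    funext y; simp only; rw [Fintype.prod_extend_by_one]
  rw [h1, GaussianToolkit.lintegral_fintype_prod_eq_prod (fun _ : ι => haarProbability Circle) hF']
  have h2 : ∀ i, (∫⁻ z, (if i ∈ P then F i z else (1 : ℝ≥0∞)) ∂(haarProbability Circle)) =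
      if i ∈ P then ∫⁻ z, F i z ∂(haarProbability Circle) else 1 := by
    intro i; split_ifs
    · rfl
    · rw [lintegral_const, measure_univ, mul_one]
  simp_rw [h2]
  rw [Fintype.prod_extend_by_one]

/-- `∫ ∏_{x∈P} w_κ(y_x) dHaar^{⊗ι} = z₁(κ)^{#P}`. [folklore] -/
theorem lintegral_prod_u1W (P : Finset ι) (κ : ℝ) :
    ∫⁻ y, ∏ x ∈ P, u1W κ (y x) ∂(Measure.pi fun _ : ι => haarProbability Circle) =
      Lattice.z1 u1Rep κ ^ P.card := by
  rw [lintegral_prod_finset_eq P fun _ => measurable_u1W κ, Finset.prod_const, z1_eq_lintegral_u1W]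

/-- `z₁` is antitone: `κ ≤ β ⇒ z₁(β) ≤ z₁(κ)`. [folklore] -/
theorem u1W_anti {κ β : ℝ} (h : κ ≤ β) (z : Circle) : u1W β z ≤ u1W κ z := by
  rw [u1W_apply, u1W_apply]
  refine ENNReal.ofReal_le_ofReal (Real.exp_le_exp.mpr (neg_le_neg ?_))
  exact mul_le_mul_of_nonneg_right h (by linarith [circle_re_le_one z])

/-- `z₁` is antitone. [folklore] -/
theorem z1_u1_anti {κ β : ℝ} (h : κ ≤ β) : Lattice.z1 u1Rep β ≤ Lattice.z1 u1Rep κ := by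
  rw [z1_eq_lintegral_u1W, z1_eq_lintegral_u1W]
  exact lintegral_mono fun z => u1W_anti h z

/-! ## §2 The moment generating function of `Im y` under the Wilson weight: the rotation trick -/

/-- **MGF BY ROTATION**: for `κ > 0` and every real `λ`,
`∫ e^{λ·Im y}·w_κ(y) dHaar(y) ≤ e^{λ²/(2κ)}·z₁(κ)`.  (`κ Re y + λ Im y = R·Re(d̄y)` with `R = |κ+iλ|`,
`d = (κ+iλ)/R`; Haar is rotation invariant; `R − κ ≤ λ²/(2κ)`; `z₁` is antitone.) [folklore] -/
theorem lintegral_exp_im_mul_u1W_le {κ : ℝ} (hκ : 0 < κ) (l : ℝ) :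
    ∫⁻ y, ENNReal.ofReal (Real.exp (l * ((y : Circle) : ℂ).im)) * u1W κ y ∂(haarProbability Circle) ≤
      ENNReal.ofReal (Real.exp (l ^ 2 / (2 * κ))) * Lattice.z1 u1Rep κ := by
  set ζ : ℂ := (κ : ℂ) + (l : ℂ) * Complex.I with hζ
  set R : ℝ := ‖ζ‖ with hRdef
  have hR : R = Real.sqrt (κ ^ 2 + l ^ 2) := by rw [hRdef, hζ, Complex.norm_add_mul_I]
  have hRκ : κ ≤ R := by
    rw [hR]
    calc κ = Real.sqrt (κ ^ 2) := (Real.sqrt_sq hκ.le).symm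
      _ ≤ Real.sqrt (κ ^ 2 + l ^ 2) := Real.sqrt_le_sqrt (by nlinarith)
  have hR0 : 0 < R := hκ.trans_le hRκ
  have hR2 : R ^ 2 = κ ^ 2 + l ^ 2 := by rw [hR, Real.sq_sqrt (by positivity)]
  have hgap : R - κ ≤ l ^ 2 / (2 * κ) := by
    rw [le_div_iff₀ (by positivity)]; nlinarith
  set d : Circle := Circle.exp (Complex.arg ζ) with hd
  have hdζ : (R : ℂ) * (d : ℂ) = ζ := by
    rw [hd, Circle.coe_exp, hRdef]; exact Complex.norm_mul_exp_arg_mul_I ζ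
  have hre : R * ((d : Circle) : ℂ).re = κ := by
    have := congrArg Complex.re hdζ
    rw [Complex.re_ofReal_mul] at this
    rw [this, hζ]; simp
  have him : R * ((d : Circle) : ℂ).im = l := by
    have := congrArg Complex.im hdζ
    rw [Complex.im_ofReal_mul] at this
    rw [this, hζ]; simp
  -- pointwise: `e^{λ Im y} w_κ(y) = e^{R−κ} w_R(d⁻¹y)`
  have hpt : ∀ y : Circle, ENNReal.ofReal (Real.exp (l * (y : ℂ).im)) * u1W κ y =
      ENNReal.ofReal (Real.exp (R - κ)) * u1W R (d⁻¹ * y) := by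
    intro y
    rw [u1W_apply, u1W_apply, (circle_re_mul d y).2, ← ENNReal.ofReal_mul (Real.exp_pos _).le,
      ← ENNReal.ofReal_mul (Real.exp_pos _).le, ← Real.exp_add, ← Real.exp_add]
    congr 2
    have h1 : R * ((d : ℂ).re * (y : ℂ).re + (d : ℂ).im * (y : ℂ).im) =
        κ * (y : ℂ).re + l * (y : ℂ).im := by rw [← hre, ← him]; ring
    linear_combination -h1
  simp_rw [hpt]
  rw [lintegral_const_mul _ (show Measurable (fun y : Circle => u1W R (d⁻¹ * y)) from
      (measurable_u1W R).comp (measurable_const_mul d⁻¹)),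
    lintegral_mul_left_eq_self (u1W R) d⁻¹, ← z1_eq_lintegral_u1W]
  exact mul_le_mul' (ENNReal.ofReal_le_ofReal (Real.exp_le_exp.mpr hgap)) (z1_u1_anti hRκ)

/-! ## §3 The events -/

omit [Fintype ι] in
/-- `Σ_{x∈P} Im y_x`. -/
def sumIm (P : Finset ι) (y : ι → Circle) : ℝ := ∑ x ∈ P, ((y x : Circle) : ℂ).im

omit [Fintype ι] in
/-- `sumIm` is continuous. -/
theorem continuous_sumIm (P : Finset ι) : Continuous (sumIm P) := by
  unfold sumIm; fun_prop

omit [Fintype ι] in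
/-- THE GOOD EVENT in the half-angle variables `y`: every `Re y_x > −C` and `Σ_x Im y_x ∈ [−η, 0]`. -/
def goodY (P : Finset ι) (η C : ℝ) : Set (ι → Circle) :=
  {y | (∀ x ∈ P, -C < ((y x : Circle) : ℂ).re) ∧ -η ≤ sumIm P y ∧ sumIm P y ≤ 0}

omit [Fintype ι] in
/-- Its mirror image `Σ_x Im y_x ∈ [0, η]`. -/
def goodY' (P : Finset ι) (η C : ℝ) : Set (ι → Circle) :=
  {y | (∀ x ∈ P, -C < ((y x : Circle) : ℂ).re) ∧ 0 ≤ sumIm P y ∧ sumIm P y ≤ η}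

omit [Fintype ι] in
/-- THE GOOD EVENT in the original variables: `g ∈ goodG ⇔ (e^{iθ}g_x)_x ∈ goodY`. -/
def goodG (P : Finset ι) (θ η C : ℝ) : Set (ι → Circle) :=
  {g | (fun x => Circle.exp θ * g x) ∈ goodY P η C}

/-- The arc condition is measurable. -/
theorem measurableSet_reGt (P : Finset ι) (C : ℝ) :
    MeasurableSet {y : ι → Circle | ∀ x ∈ P, -C < ((y x : Circle) : ℂ).re} := by
  have h : {y : ι → Circle | ∀ x ∈ P, -C < ((y x : Circle) : ℂ).re} =
      ⋂ x ∈ P, {y | -C < ((y x : Circle) : ℂ).re} := by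
    ext y; simp only [Set.mem_setOf_eq, Set.mem_iInter]
  rw [h]
  refine Finset.measurableSet_biInter P fun x _ => measurableSet_lt measurable_const ?_
  exact (Complex.continuous_re.comp (continuous_subtype_val.comp (continuous_apply x))).measurable

/-- `goodY` is measurable. -/
theorem measurableSet_goodY (P : Finset ι) (η C : ℝ) : MeasurableSet (goodY P η C) := by
  have h : goodY P η C = {y : ι → Circle | ∀ x ∈ P, -C < ((y x : Circle) : ℂ).re} ∩
      ({y | -η ≤ sumIm P y} ∩ {y | sumIm P y ≤ 0}) := by
    ext y; simp only [goodY, Set.mem_setOf_eq, Set.mem_inter_iff]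
  rw [h]
  exact (measurableSet_reGt P C).inter ((measurableSet_le measurable_const (continuous_sumIm P).measurable).inter
    (measurableSet_le (continuous_sumIm P).measurable measurable_const))

/-- `goodY'` is measurable. -/
theorem measurableSet_goodY' (P : Finset ι) (η C : ℝ) : MeasurableSet (goodY' P η C) := by
  have h : goodY' P η C = {y : ι → Circle | ∀ x ∈ P, -C < ((y x : Circle) : ℂ).re} ∩
      ({y | 0 ≤ sumIm P y} ∩ {y | sumIm P y ≤ η}) := by
    ext y; simp only [goodY', Set.mem_setOf_eq, Set.mem_inter_iff]
  rw [h]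
  exact (measurableSet_reGt P C).inter ((measurableSet_le measurable_const (continuous_sumIm P).measurable).inter
    (measurableSet_le (continuous_sumIm P).measurable measurable_const))

/-- `goodG` is measurable. -/
theorem measurableSet_goodG (P : Finset ι) (θ η C : ℝ) : MeasurableSet (goodG P θ η C) :=
  (measurableSet_goodY P η C).preimage (measurable_const_mul (fun _ : ι => Circle.exp θ))

omit [Fintype ι] in
/-- `goodG` depends only on the coordinates in `P`. -/
theorem goodG_congr (P : Finset ι) (θ η C : ℝ) (g g' : ι → Circle) (h : ∀ x ∈ P, g x = g' x) :
    g ∈ goodG P θ η C ↔ g' ∈ goodG P θ η C := by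
  have hs : sumIm P (fun x => Circle.exp θ * g x) = sumIm P (fun x => Circle.exp θ * g' x) :=
    Finset.sum_congr rfl fun x hx => by simp only [h x hx]
  simp only [goodG, goodY, Set.mem_setOf_eq, hs]
  constructor
  · rintro ⟨h1, h2⟩; exact ⟨fun x hx => h x hx ▸ h1 x hx, h2⟩
  · rintro ⟨h1, h2⟩; exact ⟨fun x hx => (h x hx).symm ▸ h1 x hx, h2⟩

/-! ## §4 The tilt identity and the transfer to the half-angle variables -/

/-- **ACTION CHANGE IN HALF-ANGLE VARIABLES**: `Re(e^{−iθ}y) − Re(e^{iθ}y) = 2 sin θ·Im y`. [folklore] -/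
theorem re_rot_sub_re_rot (θ : ℝ) (y : Circle) :
    (((Circle.exp θ)⁻¹ * y : Circle) : ℂ).re - ((Circle.exp θ * y : Circle) : ℂ).re =
      2 * Real.sin θ * (y : ℂ).im := by
  -- (the tree has `Re/Im e^{iθ} = cos θ / sin θ` as a FourManifolds lemma; used inline here)
  have him : ((Circle.exp θ : Circle) : ℂ).im = Real.sin θ := by
    rw [Circle.coe_exp]; exact Complex.exp_ofReal_mul_I_im θ
  rw [(circle_re_mul (Circle.exp θ) y).1, (circle_re_mul (Circle.exp θ) y).2, him]
  ring

/-- **THE TILT IDENTITY**: `w_β(e^{−iθ}y) = e^{−(β − β cos θ)}·e^{β sin θ·Im y}·w_{β cos θ}(y)`. [folklore] -/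
theorem u1W_rot_eq (β θ : ℝ) (y : Circle) :
    u1W β ((Circle.exp θ)⁻¹ * y) =
      ENNReal.ofReal (Real.exp (-(β - β * Real.cos θ)) * Real.exp (β * Real.sin θ * (y : ℂ).im)) *
        u1W (β * Real.cos θ) y := by
  have hre : ((Circle.exp θ : Circle) : ℂ).re = Real.cos θ := by
    rw [Circle.coe_exp]; exact Complex.exp_ofReal_mul_I_re θ
  have him : ((Circle.exp θ : Circle) : ℂ).im = Real.sin θ := by
    rw [Circle.coe_exp]; exact Complex.exp_ofReal_mul_I_im θ
  rw [u1W_apply, u1W_apply, (circle_re_mul (Circle.exp θ) y).2, hre, him,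
    ← ENNReal.ofReal_mul (by positivity), ← Real.exp_add, ← Real.exp_add]
  congr 2; ring

omit [Fintype ι] in
/-- The product of the tilt factors on the good event: for `t ≥ 0` and `Σ_x Im y_x ≥ −η`,
`e^{−tη} ≤ ∏_{x∈P} e^{t·Im y_x}`. [folklore] -/
theorem exp_neg_le_prod_exp (P : Finset ι) {t η : ℝ} (ht : 0 ≤ t) (y : ι → Circle)
    (hy : -η ≤ sumIm P y) :
    Real.exp (-(t * η)) ≤ ∏ x ∈ P, Real.exp (t * ((y x : Circle) : ℂ).im) := by
  rw [← Real.exp_sum, ← Finset.mul_sum]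
  exact Real.exp_le_exp.mpr (by unfold sumIm at hy; nlinarith)

/-- **TRANSFER TO THE HALF-ANGLE VARIABLES** (`β ≥ 0`, `sin θ ≥ 0`, `N = #P`):
`e^{−(N(β − β cos θ) + β sin θ·η)}·∫ 1_{goodY}(y)·∏_x w_{β cos θ}(y_x) dHaar^{⊗ι}
   ≤ ∫ 1_{goodG}(g)·∏_x w_β(g_x) dHaar^{⊗ι}`. [folklore] -/
theorem lintegral_goodG_ge (P : Finset ι) {β θ η C : ℝ} (hβ : 0 ≤ β) (hsin : 0 ≤ Real.sin θ) :
    ENNReal.ofReal (Real.exp (-(P.card * (β - β * Real.cos θ) + β * Real.sin θ * η))) *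
        ∫⁻ y, (goodY P η C).indicator 1 y * ∏ x ∈ P, u1W (β * Real.cos θ) (y x)
          ∂(Measure.pi fun _ : ι => haarProbability Circle) ≤
      ∫⁻ g, (goodG P θ η C).indicator 1 g * ∏ x ∈ P, u1W β (g x)
          ∂(Measure.pi fun _ : ι => haarProbability Circle) := by
  set c : Circle := Circle.exp θ with hc
  -- substitute `g = c⁻¹ y`
  rw [← lintegral_mul_left_eq_self (fun g : ι → Circle =>
      (goodG P θ η C).indicator 1 g * ∏ x ∈ P, u1W β (g x)) (fun _ : ι => c⁻¹),
    ← lintegral_const_mul' _ _ ENNReal.ofReal_ne_top]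
  refine lintegral_mono fun y => ?_
  have hmem : ((fun _ : ι => c⁻¹) * y) ∈ goodG P θ η C ↔ y ∈ goodY P η C := by
    simp only [goodG, Set.mem_setOf_eq, Pi.mul_apply, ← hc, mul_inv_cancel_left]
  by_cases hy : y ∈ goodY P η C
  · simp only [Set.indicator_of_mem hy, Set.indicator_of_mem (hmem.mpr hy), Pi.one_apply, one_mul, Pi.mul_apply]
    simp_rw [hc, u1W_rot_eq β θ]
    rw [Finset.prod_mul_distrib, ← ENNReal.ofReal_prod_of_nonneg (fun _ _ => by positivity),
      Finset.prod_mul_distrib, Finset.prod_const]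
    refine mul_le_mul_left (ENNReal.ofReal_le_ofReal ?_) _
    rw [neg_add, Real.exp_add, ← Real.exp_nat_mul]
    refine mul_le_mul (le_of_eq (congrArg Real.exp (by ring))) ?_ (Real.exp_pos _).le (Real.exp_pos _).le
    exact exp_neg_le_prod_exp P (mul_nonneg hβ hsin) y hy.2.1
  · rw [Set.indicator_of_notMem hy, zero_mul, mul_zero]
    exact zero_le

end Summit.Ventures.LatticeQCDFlow.Theory2.HaarConv

end
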